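import Mathlib
import HarnessLib
import Literature.MathematicalPhysics.KineticTheory.HardSphereEulerProofs
import Summits.AtomisticToContinuum.HydrodynamicLimit.Theses.OneFlightGossipEngine
import Summits.AtomisticToContinuum.HydrodynamicLimit.Theorems.OneFlightGossipEngineKineticCurrentsWindowLDUniformFibreExpMoment
import Summits.AtomisticToContinuum.HydrodynamicLimit.Theorems.OneFlightGossipEngineKineticCurrentsWindowLDUniformStaticFreezingStatics
import Summits.AtomisticToContinuum.HydrodynamicLimit.Theorems.OneFlightGossipEngineKineticCurrentsWindowLDUniformEntropyQuasiInvariance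

/-!
# Change of reference law along a profile family — stub `stub_lawChangeFamily` of line `Sketch`,
# crux `KineticCurrentsLDAlongFamilies` (stmt-AtomisticToContinuum-16659)

Route `OneFlightGossipEngine`, sub-problem `HydrodynamicLimit`, stub S5 of
`Cruxes/KineticCurrentsLDAlongFamilies/Lines/Sketch.lean`: along a jointly continuous positive
profile family on `[0, t₁] × 𝕋³` (`0 < σ ≤ 1/2`, `κ > 0`) there is `δ > 0` with
`∫ g dλ_{s'} ≤ (∫ g² dλ_s)^{1/2} · e^{κ(N+1)}` for all `N`, all `|s − s'| ≤ δ` in `[0, t₁]` and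
all Liouville-a.e.-measurable `g ≥ 0` (`λ_s = ψ_s dL` the local Gibbs law at parameter `s`;
STATIC, the flow only fixes the type). Proof: Cauchy–Schwarz in `ℝ≥0∞` with
`ψ_{s'} g = (g ψ_s^{1/2})(ψ_{s'} ψ_s^{-1/2})` (`LawChange.lintegral_le_of_renyi_two`); the
order-`2` Rényi integral `∫ ψ_{s'}² ψ_s⁻¹ dL ≤ e^{2κ(N+1)}` once the data
`(log a, log θ₀, u₀, θ₀⁻¹)` at `s`, `s'` differ by less than a tolerance `e(κ, Θ)`
(`LawChange.renyi_le_of_close`, the statics of `stub_staticFreezing` of crux 14662 with the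
frozen profiles replaced by the neighbouring family member), met by uniform continuity on the
compact `[0, t₁] × 𝕋³` (`LawChange.exists_family_modulus`). Reference: Spohn (1991), I §2.3.
-/

noncomputable section

open MeasureTheory Set Filter
open scoped ENNReal Topology

namespace Summit.AtomisticToContinuum.HydrodynamicLimit.Theorems.KineticCurrentsLDAlongFamiliesSketch

open Literature.Analysis.FluidPDE (HardSphereFlow Config localMaxwellian canonicalDensity liouville)
open Literature.MathematicalPhysics.KineticTheory (T3 V3 hsDiameter localGibbsLaw localGibbsMeasure
  localGibbsProfile)
open Literature.Analysis.FluidPDE Literature.MathematicalPhysics.KineticTheory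

namespace LawChange

/-- `(ofReal (exp (p x)))^{1/p} = ofReal (exp x)` for `p > 0`. [folklore] -/
theorem ofReal_exp_mul_rpow_inv {p : ℝ} (hp : 0 < p) (x : ℝ) :
    ENNReal.ofReal (Real.exp (p * x)) ^ (1 / p) = ENNReal.ofReal (Real.exp x) := by
  rw [ENNReal.ofReal_rpow_of_nonneg (Real.exp_pos _).le (one_div_pos.2 hp).le, ← Real.exp_mul,
    mul_comm p x, mul_assoc, mul_one_div_cancel hp.ne', mul_one]

/-- **Transverse modulus of a jointly continuous family**: a continuous `F : ℝ × 𝕋³ → M` is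
uniformly continuous on the compact `[0, t₁] × 𝕋³`, so `dist (F (s, x)) (F (s', x)) < e` once
`s, s' ∈ [0, t₁]`, `|s − s'| ≤ δ(e)` (the sup-distance of the points is `|s − s'|`). [folklore] -/
theorem exists_family_modulus {M : Type*} [PseudoMetricSpace M] (t₁ : ℝ) {F : ℝ × T3 → M}
    (hF : Continuous F) {e : ℝ} (he : 0 < e) :
    ∃ δ : ℝ, 0 < δ ∧ ∀ s ∈ Icc 0 t₁, ∀ s' ∈ Icc 0 t₁, |s - s'| ≤ δ →
      ∀ x : T3, dist (F (s, x)) (F (s', x)) < e := by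
  have hK : IsCompact (Icc (0 : ℝ) t₁ ×ˢ (univ : Set T3)) := isCompact_Icc.prod isCompact_univ
  have hUC := hK.uniformContinuousOn_of_continuous hF.continuousOn
  rw [Metric.uniformContinuousOn_iff_le] at hUC
  obtain ⟨δ, hδ, h⟩ := hUC (e / 2) (half_pos he)
  refine ⟨δ, hδ, fun s hs s' hs' hss' x => ?_⟩
  have hd : dist (s, x) (s', x) ≤ δ := by
    rw [Prod.dist_eq, dist_self, max_eq_left dist_nonneg, Real.dist_eq]; exact hss'
  calc dist (F (s, x)) (F (s', x)) ≤ e / 2 :=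
        h (s, x) (Set.mk_mem_prod hs (mem_univ x)) (s', x) (Set.mk_mem_prod hs' (mem_univ x)) hd
    _ < e := half_lt_self he

/-- **Cauchy–Schwarz change of reference law.** For two local Gibbs laws `λ = ψ dL`,
`λ' = ψ' dL` of `N + 1` hard spheres (continuous profiles, `a', θ₀' > 0`, `σ ≤ 1/2`, so `ψ' > 0`
on the hard-sphere domain) and Liouville-a.e.-measurable `g ≥ 0`: if `∫ ψ² ψ'⁻¹ dL ≤ B` then
`∫ g dλ ≤ (∫ g² dλ')^{1/2} B^{1/2}` (Hölder in `ℝ≥0∞`, `p = q = 2`). [folklore] -/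
theorem lintegral_le_of_renyi_two {σ : ℝ} {a a' θ₀ θ₀' : T3 → ℝ} {u₀ u₀' : T3 → V3}
    (ha : Continuous a) (hθ : Continuous θ₀) (hu : Continuous u₀)
    (ha' : Continuous a') (hθ' : Continuous θ₀') (hu' : Continuous u₀')
    (ha0' : ∀ x, 0 < a' x) (hθ0' : ∀ x, 0 < θ₀' x) (hσ2 : σ ≤ 1 / 2) {N : ℕ}
    (Φ : HardSphereFlow (Literature.Analysis.FluidPDE.Torus.geometry (Fin 3)) (hsDiameter σ N)
      (N + 1)) (B : ℝ≥0∞)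
    (hR : ∫⁻ z, ENNReal.ofReal (canonicalDensity (Literature.Analysis.FluidPDE.Torus.geometry (Fin 3))
              (hsDiameter σ N) (N + 1) (localGibbsProfile a u₀ θ₀) z) ^ (2 : ℝ) *
            ENNReal.ofReal (canonicalDensity (Literature.Analysis.FluidPDE.Torus.geometry (Fin 3))
              (hsDiameter σ N) (N + 1) (localGibbsProfile a' u₀' θ₀') z) ^ (1 - 2 : ℝ)
          ∂(liouville (Literature.Analysis.FluidPDE.Torus.geometry (Fin 3)) (N + 1)
            (hsDiameter σ N)) ≤ B)
    (g : Config (N + 1) (Fin 3) T3 → ℝ≥0∞)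
    (hg : AEMeasurable g
      (liouville (Literature.Analysis.FluidPDE.Torus.geometry (Fin 3)) (N + 1) (hsDiameter σ N))) :
    ∫⁻ z, g z ∂(localGibbsLaw σ a u₀ θ₀ N Φ) ≤
      (∫⁻ z, g z ^ 2 ∂(localGibbsLaw σ a' u₀' θ₀' N Φ)) ^ (1 / 2 : ℝ) * B ^ (1 / 2 : ℝ) := by
  set L := liouville (Literature.Analysis.FluidPDE.Torus.geometry (Fin 3)) (N + 1) (hsDiameter σ N)
    with hL
  set ψ : Config (N + 1) (Fin 3) T3 → ℝ≥0∞ := fun z => ENNReal.ofReal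
    (canonicalDensity (Literature.Analysis.FluidPDE.Torus.geometry (Fin 3)) (hsDiameter σ N) (N + 1)
      (localGibbsProfile a u₀ θ₀) z) with hψ
  set ψ' : Config (N + 1) (Fin 3) T3 → ℝ≥0∞ := fun z => ENNReal.ofReal
    (canonicalDensity (Literature.Analysis.FluidPDE.Torus.geometry (Fin 3)) (hsDiameter σ N) (N + 1)
      (localGibbsProfile a' u₀' θ₀') z) with hψ'
  have hlaw : localGibbsLaw σ a u₀ θ₀ N Φ = L.withDensity ψ := rfl
  have hlaw' : localGibbsLaw σ a' u₀' θ₀' N Φ = L.withDensity ψ' := rfl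
  have hψm : Measurable ψ :=
    (measurable_canonicalDensity (hsDiameter σ N) (N + 1)
      (measurable_localGibbsProfile ha hθ hu)).ennreal_ofReal
  have hψm' : Measurable ψ' :=
    (measurable_canonicalDensity (hsDiameter σ N) (N + 1)
      (measurable_localGibbsProfile ha' hθ' hu')).ennreal_ofReal
  have hψt : ∀ᵐ z ∂L, ψ z < ∞ := Eventually.of_forall fun z => ENNReal.ofReal_lt_top
  have hψ't' : ∀ᵐ z ∂L, ψ' z < ∞ := Eventually.of_forall fun z => ENNReal.ofReal_lt_top
  have haeD : ∀ᵐ z ∂L, z ∈ hardSphereDomain (Literature.Analysis.FluidPDE.Torus.geometry (Fin 3))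
      (N + 1) (hsDiameter σ N) :=
    ae_restrict_mem (measurableSet_hardSphereDomain _ Torus.measurable_geometry_sepVec _ _)
  have hψ'0 : ∀ z ∈ hardSphereDomain (Literature.Analysis.FluidPDE.Torus.geometry (Fin 3)) (N + 1)
      (hsDiameter σ N), ψ' z ≠ 0 := fun z hz =>
    (ENNReal.ofReal_pos.2 (KineticCurrentsWindowLDUniformLocalGibbs.eqi_canonicalDensity_pos_of_mem
      ha' hθ' hu' ha0' hθ0' hσ2 hz)).ne'
  have hψ't : ∀ z, ψ' z ≠ ⊤ := fun z => ENNReal.ofReal_ne_top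
  have hpq : (2 : ℝ).HolderConjugate 2 := Real.HolderConjugate.two_two
  set f : Config (N + 1) (Fin 3) T3 → ℝ≥0∞ := fun z => g z * ψ' z ^ (1 / (2 : ℝ)) with hf
  set h : Config (N + 1) (Fin 3) T3 → ℝ≥0∞ := fun z => ψ z * (ψ' z)⁻¹ ^ (1 / (2 : ℝ)) with hh
  have hfm : AEMeasurable f L := hg.mul (hψm'.pow_const _).aemeasurable
  have hhm : Measurable h := hψm.mul (hψm'.inv.pow_const _)
  have hI1 : ∫⁻ z, g z ∂(localGibbsLaw σ a u₀ θ₀ N Φ) = ∫⁻ z, (f * h) z ∂L := by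
    rw [hlaw, lintegral_withDensity_eq_lintegral_mul_non_measurable L hψm hψt]
    refine lintegral_congr_ae ?_
    filter_upwards [haeD] with z hz
    simp only [hf, hh, Pi.mul_apply]
    calc ψ z * g z = ψ z * g z * (ψ' z * (ψ' z)⁻¹) ^ (1 / (2 : ℝ)) := by
          rw [ENNReal.mul_inv_cancel (hψ'0 z hz) (hψ't z), ENNReal.one_rpow, mul_one]
      _ = g z * ψ' z ^ (1 / (2 : ℝ)) * (ψ z * (ψ' z)⁻¹ ^ (1 / (2 : ℝ))) := by
          rw [ENNReal.mul_rpow_of_nonneg _ _ hpq.symm.one_div_nonneg]; ring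
  have hI2 : ∫⁻ z, f z ^ (2 : ℝ) ∂L = ∫⁻ z, g z ^ 2 ∂(localGibbsLaw σ a' u₀' θ₀' N Φ) := by
    rw [hlaw', lintegral_withDensity_eq_lintegral_mul_non_measurable L hψm' hψ't']
    refine lintegral_congr fun z => ?_
    simp only [hf, Pi.mul_apply]
    rw [ENNReal.mul_rpow_of_nonneg _ _ hpq.symm.nonneg, ← ENNReal.rpow_mul,
      one_div_mul_cancel (two_ne_zero : (2 : ℝ) ≠ 0), ENNReal.rpow_one, ENNReal.rpow_two,
      mul_comm]
  have hI3 : ∫⁻ z, h z ^ (2 : ℝ) ∂L = ∫⁻ z, ψ z ^ (2 : ℝ) * ψ' z ^ (1 - 2 : ℝ) ∂L := by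
    refine lintegral_congr fun z => ?_
    simp only [hh]
    rw [ENNReal.mul_rpow_of_nonneg _ _ hpq.nonneg, ← ENNReal.rpow_mul, ENNReal.inv_rpow,
      ← ENNReal.rpow_neg]
    congr 2; norm_num
  calc ∫⁻ z, g z ∂(localGibbsLaw σ a u₀ θ₀ N Φ) = ∫⁻ z, (f * h) z ∂L := hI1
    _ ≤ (∫⁻ z, f z ^ (2 : ℝ) ∂L) ^ (1 / (2 : ℝ)) * (∫⁻ z, h z ^ (2 : ℝ) ∂L) ^ (1 / (2 : ℝ)) :=
        ENNReal.lintegral_mul_le_Lp_mul_Lq L hpq hfm hhm.aemeasurable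
    _ ≤ (∫⁻ z, g z ^ 2 ∂(localGibbsLaw σ a' u₀' θ₀' N Φ)) ^ (1 / 2 : ℝ) * B ^ (1 / 2 : ℝ) := by
        rw [hI2, hI3]
        exact mul_le_mul_right (ENNReal.rpow_le_rpow hR (by norm_num)) _

/-- **Static Rényi cost of changing the local Gibbs profiles** (statics of `stub_staticFreezing`,
crux 14662, for two continuous positive profile triples, `0 < σ ≤ 1/2`, order `p > 1`): if
`θ₀' ≥ θₘ > 0`, `θ₀ ≤ Θ`, `a ≤ Aₘ` and the data `(log a, log θ₀, u₀, θ₀⁻¹)` differ by less than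
a tolerance `e ∈ (0, 1]` tuned to `(p, δ)`, then `∫ ψ^p ψ'^{1-p} dL ≤ exp(pδ(N+1))` for the
canonical densities `ψ, ψ'` of `N + 1` hard spheres (`StaticFreezing.log_ratio_le`,
`StaticFreezing.canonicalPartition_le_pow_mul`, `stub_fibreExpMoment`). [folklore] -/
theorem renyi_le_of_close {a a' θ₀ θ₀' : T3 → ℝ} {u₀ u₀' : T3 → V3}
    (ha : Continuous a) (hθ : Continuous θ₀) (hu : Continuous u₀)
    (ha' : Continuous a') (hθ' : Continuous θ₀') (hu' : Continuous u₀')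
    (ha0 : ∀ x, 0 < a x) (hθ0 : ∀ x, 0 < θ₀ x) (ha0' : ∀ x, 0 < a' x) (hθ0' : ∀ x, 0 < θ₀' x)
    {σ : ℝ} (hσ : 0 < σ) (hσ2 : σ ≤ 1 / 2) {p δ e θm Θ Am : ℝ} (hp : 1 < p)
    (hθm0 : 0 < θm) (hθm : ∀ x, θm ≤ θ₀' x) (hΘ : ∀ x, θ₀ x ≤ Θ) (hAm : ∀ x, a x ≤ Am)
    (he0 : 0 < e) (he1 : e ≤ 1) (hBe : (p - 1) * ((1 + θm⁻¹) * Θ) * e ≤ 1 / 2)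
    (hKe : Real.exp ((p - 1) * (7 / 2 + θm⁻¹) * e) *
        (1 - (p - 1) * ((1 + θm⁻¹) * Θ) * e) ^ (-(3 : ℝ) / 2) ≤ Real.exp (p * δ))
    (hla : ∀ x, |Real.log (a' x) - Real.log (a x)| < e)
    (hlθ : ∀ x, |Real.log (θ₀' x) - Real.log (θ₀ x)| < e)
    (hlu : ∀ x, ‖u₀ x - u₀' x‖ < e) (hlι : ∀ x, |(θ₀' x)⁻¹ - (θ₀ x)⁻¹| < e) (N : ℕ) :
    ∫⁻ z, ENNReal.ofReal (canonicalDensity (Literature.Analysis.FluidPDE.Torus.geometry (Fin 3))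
          (hsDiameter σ N) (N + 1) (localGibbsProfile a u₀ θ₀) z) ^ p *
        ENNReal.ofReal (canonicalDensity (Literature.Analysis.FluidPDE.Torus.geometry (Fin 3))
          (hsDiameter σ N) (N + 1) (localGibbsProfile a' u₀' θ₀') z) ^ (1 - p)
      ∂(liouville (Literature.Analysis.FluidPDE.Torus.geometry (Fin 3)) (N + 1) (hsDiameter σ N)) ≤
    ENNReal.ofReal (Real.exp (p * (δ * ((N : ℝ) + 1)))) := by
  have hp1 : 0 < p - 1 := sub_pos.2 hp
  have haπ_le : ∀ y, a' y ≤ Real.exp e * a y := fun y => by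
    have h := (abs_lt.1 (hla y)).2
    calc a' y = Real.exp (Real.log (a' y)) := (Real.exp_log (ha0' _)).symm
      _ ≤ Real.exp (e + Real.log (a y)) := Real.exp_le_exp.2 (by linarith)
      _ = Real.exp e * a y := by rw [Real.exp_add, Real.exp_log (ha0 _)]
  obtain ⟨s, hs⟩ : ∃ s : ℝ, s = (p - 1) * (e * (1 + θm⁻¹) / 2) := ⟨_, rfl⟩
  have hs0 : 0 ≤ s := by rw [hs]; positivity
  have hsΘ : 2 * s * Θ < 1 := by rw [hs]; nlinarith
  obtain ⟨C₁, hC₁⟩ : ∃ C₁ : ℝ, C₁ = Real.exp ((p - 1) * (e + e * (5 / 2 + θm⁻¹))) := ⟨_, rfl⟩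
  have hC₁0 : 0 < C₁ := by rw [hC₁]; exact Real.exp_pos _
  obtain ⟨K, hK⟩ : ∃ K : ℝ, K = (1 - 2 * s * Θ) ^ (-(3 : ℝ) / 2) := ⟨_, rfl⟩
  have hK0 : 0 ≤ K := by rw [hK]; exact Real.rpow_nonneg (by linarith) _
  have hCK : C₁ * K ≤ Real.exp (p * δ) := by
    have h1 : C₁ = Real.exp ((p - 1) * (7 / 2 + θm⁻¹) * e) := by rw [hC₁]; congr 1; ring
    have h2 : K = (1 - (p - 1) * ((1 + θm⁻¹) * Θ) * e) ^ (-(3 : ℝ) / 2) := by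
      rw [hK, hs]; congr 1; ring
    rw [h1, h2]; exact hKe
  set ε := hsDiameter σ N with hε
  set f := localGibbsProfile a u₀ θ₀ with hf
  set g := localGibbsProfile a' u₀' θ₀' with hg
  set Z := canonicalPartition (Torus.geometry (Fin 3)) ε (N + 1) f with hZ
  set Zπ := canonicalPartition (Torus.geometry (Fin 3)) ε (N + 1) g with hZπ
  have hZpos : 0 < Z := by
    rw [hZ, hf, canonicalPartition_eq_posPartition ha hθ hu (fun x => (ha0 x).le) hθ0]
    exact posPartition_pos ha ha0 hσ2 N
  have hZπpos : 0 < Zπ := by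
    rw [hZπ, hg, canonicalPartition_eq_posPartition ha' hθ' hu' (fun x => (ha0' x).le) hθ0']
    exact posPartition_pos ha' ha0' hσ2 N
  have hZπ_le : Zπ ≤ Real.exp e ^ (N + 1) * Z :=
    KineticCurrentsWindowLDUniformSigmaUniform.StaticFreezing.canonicalPartition_le_pow_mul
      ha'.measurable hθ'.measurable hu'.measurable ha.measurable hθ.measurable hu.measurable
      (fun x => (ha0' x).le) (fun x => (ha0 x).le) hAm (fun x => hθ0' x) hθ0
      (Real.exp_pos e).le haπ_le ε (N + 1)
  have hlogZ : Real.log Zπ - Real.log Z ≤ (N + 1 : ℕ) * e := by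
    have h := Real.log_le_log hZπpos hZπ_le
    rw [Real.log_mul (pow_pos (Real.exp_pos e) _).ne' hZpos.ne', Real.log_pow, Real.log_exp] at h
    linarith
  obtain ⟨G, hGdef⟩ : ∃ G : T3 × V3 → ℝ≥0∞,
      G = fun y => ENNReal.ofReal (Real.exp (s * ‖y.2 - u₀ y.1‖ ^ 2)) := ⟨_, rfl⟩
  have hGm : Measurable G := by rw [hGdef]; fun_prop
  have hGpm : Measurable fun z : Config (N + 1) (Fin 3) T3 => ∏ i, G (z i) :=
    Finset.measurable_prod _ fun i _ => hGm.comp (measurable_pi_apply i)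
  have hfib : ∀ x : T3, ∫⁻ v, G (x, v) * ENNReal.ofReal (localMaxwellian 1 (θ₀ x) (u₀ x) v) ≤
      ENNReal.ofReal K := fun x => by
    rw [hGdef, hK]
    exact KineticCurrentsWindowLDUniformSigmaUniform.StaticFreezing.lintegral_exp_mul_localMaxwellian_le
      (hθ0 x) (hΘ x) hs0 hsΘ (u₀ x)
  have hψm : Measurable fun z => ENNReal.ofReal
      (canonicalDensity (Torus.geometry (Fin 3)) ε (N + 1) f z) :=
    (measurable_canonicalDensity ε (N + 1) (measurable_localGibbsProfile ha hθ hu)).ennreal_ofReal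
  have hDm : MeasurableSet (hardSphereDomain (Torus.geometry (Fin 3)) (N + 1) ε) :=
    measurableSet_hardSphereDomain _ Torus.measurable_geometry_sepVec (N + 1) ε
  have hpt : ∀ z ∈ hardSphereDomain (Torus.geometry (Fin 3)) (N + 1) ε,
      ENNReal.ofReal (canonicalDensity (Torus.geometry (Fin 3)) ε (N + 1) f z) ^ p *
        ENNReal.ofReal (canonicalDensity (Torus.geometry (Fin 3)) ε (N + 1) g z) ^ (1 - p) ≤
      ENNReal.ofReal (C₁ ^ (N + 1)) *
        (ENNReal.ofReal (canonicalDensity (Torus.geometry (Fin 3)) ε (N + 1) f z) *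
          ∏ i, G (z i)) := by
    intro z hz
    have hfpos : ∀ i, 0 < f (z i) := fun i =>
      mul_pos (ha0 _) (localMaxwellian_pos one_pos (hθ0 _) _ _)
    have hgpos : ∀ i, 0 < g (z i) := fun i =>
      mul_pos (ha0' _) (localMaxwellian_pos one_pos (hθ0' _) _ _)
    have hFpos : 0 < ∏ i, f (z i) := Finset.prod_pos fun i _ => hfpos i
    have hGpos : 0 < ∏ i, g (z i) := Finset.prod_pos fun i _ => hgpos i
    have hψ : canonicalDensity (Torus.geometry (Fin 3)) ε (N + 1) f z = Z⁻¹ * ∏ i, f (z i) := by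
      rw [canonicalDensity, indicator_of_mem hz]; rfl
    have hψπ : canonicalDensity (Torus.geometry (Fin 3)) ε (N + 1) g z = Zπ⁻¹ * ∏ i, g (z i) := by
      rw [canonicalDensity, indicator_of_mem hz]; rfl
    have hψpos : 0 < Z⁻¹ * ∏ i, f (z i) := mul_pos (inv_pos.2 hZpos) hFpos
    have hψπpos : 0 < Zπ⁻¹ * ∏ i, g (z i) := mul_pos (inv_pos.2 hZπpos) hGpos
    have hGz : ∏ i, G (z i) = ENNReal.ofReal (∏ i, Real.exp (s * ‖(z i).2 - u₀ (z i).1‖ ^ 2)) :=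
      by rw [hGdef, ENNReal.ofReal_prod_of_nonneg fun i _ => Real.exp_nonneg _]
    rw [hψ, hψπ, hGz, ENNReal.ofReal_rpow_of_pos hψpos, ENNReal.ofReal_rpow_of_pos hψπpos,
      ← ENNReal.ofReal_mul (Real.rpow_nonneg hψpos.le _),
      ← ENNReal.ofReal_mul hψpos.le, ← ENNReal.ofReal_mul (pow_nonneg hC₁0.le _)]
    refine ENNReal.ofReal_le_ofReal ?_
    rw [Real.rpow_def_of_pos hψpos, Real.rpow_def_of_pos hψπpos, ← Real.exp_add]
    have hLψ : Real.log (Z⁻¹ * ∏ i, f (z i)) = -Real.log Z + ∑ i, Real.log (f (z i)) := by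
      rw [Real.log_mul (inv_pos.2 hZpos).ne' hFpos.ne', Real.log_inv,
        Real.log_prod fun i _ => (hfpos i).ne']
    have hLψπ : Real.log (Zπ⁻¹ * ∏ i, g (z i)) = -Real.log Zπ + ∑ i, Real.log (g (z i)) := by
      rw [Real.log_mul (inv_pos.2 hZπpos).ne' hGpos.ne', Real.log_inv,
        Real.log_prod fun i _ => (hgpos i).ne']
    have hrhs : C₁ ^ (N + 1) * ((Z⁻¹ * ∏ i, f (z i)) *
        ∏ i, Real.exp (s * ‖(z i).2 - u₀ (z i).1‖ ^ 2)) =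
        Real.exp ((N + 1 : ℕ) * ((p - 1) * (e + e * (5 / 2 + θm⁻¹))) +
          (Real.log (Z⁻¹ * ∏ i, f (z i)) + ∑ i, s * ‖(z i).2 - u₀ (z i).1‖ ^ 2)) := by
      rw [Real.exp_add, Real.exp_add, Real.exp_nat_mul, ← hC₁, Real.exp_log hψpos, Real.exp_sum]
    rw [hrhs]
    refine Real.exp_le_exp.2 ?_
    have hpp : ∀ i, Real.log (f (z i)) - Real.log (g (z i)) ≤
        e * (5 / 2 + θm⁻¹) + e * (1 + θm⁻¹) / 2 * ‖(z i).2 - u₀ (z i).1‖ ^ 2 := fun i =>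
      KineticCurrentsWindowLDUniformSigmaUniform.StaticFreezing.log_ratio_le (ha0 _) (ha0' _)
        (hθ0 _) (hθ0' _) hθm0 (hθm _) he0.le he1
        (by linarith [(abs_lt.1 (hla (z i).1)).1]) (abs_lt.1 (hlθ (z i).1)).2.le
        (hlu (z i).1).le (abs_lt.1 (hlι (z i).1)).2.le (z i).2
    have hsum : ∑ i, (Real.log (f (z i)) - Real.log (g (z i))) ≤
        ∑ i, (e * (5 / 2 + θm⁻¹) + e * (1 + θm⁻¹) / 2 * ‖(z i).2 - u₀ (z i).1‖ ^ 2) :=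
      Finset.sum_le_sum fun i _ => hpp i
    rw [Finset.sum_sub_distrib, Finset.sum_add_distrib, Finset.sum_const, Finset.card_univ,
      Fintype.card_fin, nsmul_eq_mul, ← Finset.mul_sum] at hsum
    have hQ0 : 0 ≤ ∑ i, ‖(z i).2 - u₀ (z i).1‖ ^ 2 := Finset.sum_nonneg fun i _ => sq_nonneg _
    have hkey : Real.log (Z⁻¹ * ∏ i, f (z i)) - Real.log (Zπ⁻¹ * ∏ i, g (z i)) ≤
        (N + 1 : ℕ) * e + ((N + 1 : ℕ) * (e * (5 / 2 + θm⁻¹)) +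
          e * (1 + θm⁻¹) / 2 * ∑ i, ‖(z i).2 - u₀ (z i).1‖ ^ 2) := by
      rw [hLψ, hLψπ]
      linarith
    have hkey' := mul_le_mul_of_nonneg_left hkey hp1.le
    rw [← Finset.mul_sum, hs]
    nlinarith [hkey', hQ0]
  have hLG : localGibbsMeasure σ a u₀ θ₀ N = volume.withDensity fun z => ENNReal.ofReal
      (canonicalDensity (Torus.geometry (Fin 3)) ε (N + 1) f z) := rfl
  rw [liouville_eq]
  calc ∫⁻ z in hardSphereDomain (Torus.geometry (Fin 3)) (N + 1) ε,
        ENNReal.ofReal (canonicalDensity (Torus.geometry (Fin 3)) ε (N + 1) f z) ^ p *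
          ENNReal.ofReal (canonicalDensity (Torus.geometry (Fin 3)) ε (N + 1) g z) ^ (1 - p)
      ≤ ∫⁻ z in hardSphereDomain (Torus.geometry (Fin 3)) (N + 1) ε,
          ENNReal.ofReal (C₁ ^ (N + 1)) *
            (ENNReal.ofReal (canonicalDensity (Torus.geometry (Fin 3)) ε (N + 1) f z) *
              ∏ i, G (z i)) := setLIntegral_mono' hDm hpt
    _ ≤ ∫⁻ z, ENNReal.ofReal (C₁ ^ (N + 1)) *
            (ENNReal.ofReal (canonicalDensity (Torus.geometry (Fin 3)) ε (N + 1) f z) *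
              ∏ i, G (z i)) := setLIntegral_le_lintegral _ _
    _ = ENNReal.ofReal (C₁ ^ (N + 1)) * ∫⁻ z, ∏ i, G (z i) ∂(localGibbsMeasure σ a u₀ θ₀ N) := by
        rw [lintegral_const_mul' _ _ ENNReal.ofReal_ne_top, hLG,
          lintegral_withDensity_eq_lintegral_mul _ hψm hGpm]
        rfl
    _ ≤ ENNReal.ofReal (C₁ ^ (N + 1)) * ENNReal.ofReal K ^ (N + 1) :=
        mul_le_mul_right (KineticCurrentsWindowLDUniformSketch.stub_fibreExpMoment a θ₀ u₀ ha hθ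
          hu ha0 hθ0 σ hσ hσ2 N G hGm _ hfib) _
    _ ≤ ENNReal.ofReal (Real.exp (p * (δ * ((N : ℝ) + 1)))) := by
        rw [← ENNReal.ofReal_pow hK0, ← ENNReal.ofReal_mul (pow_nonneg hC₁0.le _), ← mul_pow]
        refine ENNReal.ofReal_le_ofReal ?_
        calc (C₁ * K) ^ (N + 1) ≤ Real.exp (p * δ) ^ (N + 1) :=
              pow_le_pow_left₀ (mul_nonneg hC₁0.le hK0) hCK _
          _ = Real.exp (p * (δ * ((N : ℝ) + 1))) := by
              rw [← Real.exp_nat_mul]; congr 1; push_cast; ring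

/-- Two-sided bounds of a jointly continuous positive family on `[0, t₁] × 𝕋³`. [folklore] -/
theorem exists_bounds (t₁ : ℝ) {f : ℝ → T3 → ℝ} (hf : Continuous (Function.uncurry f))
    (hpos : ∀ s x, 0 < f s x) :
    ∃ M : ℝ, 0 < M ∧ ∀ s ∈ Icc 0 t₁, ∀ x, M⁻¹ ≤ f s x ∧ f s x ≤ M := by
  have hK : IsCompact (Icc (0 : ℝ) t₁ ×ˢ (univ : Set T3)) := isCompact_Icc.prod isCompact_univ
  obtain ⟨C, hC⟩ := hK.exists_bound_of_continuousOn hf.continuousOn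
  obtain ⟨C', hC'⟩ := hK.exists_bound_of_continuousOn
    (hf.inv₀ fun p => (hpos p.1 p.2).ne').continuousOn
  refine ⟨max 1 (max C C'), by positivity, fun s hs x => ⟨?_, (Real.le_norm_self _).trans
    ((hC (s, x) (mk_mem_prod hs (mem_univ _))).trans (le_max_of_le_right (le_max_left _ _)))⟩⟩
  rw [inv_le_comm₀ (by positivity) (hpos s x)]
  exact (Real.le_norm_self _).trans
    ((hC' (s, x) (mk_mem_prod hs (mem_univ _))).trans (le_max_of_le_right (le_max_right _ _)))

end LawChange

/-- **S5 — change of reference law along the family** (stub `stub_lawChangeFamily` of line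
`Sketch`, crux `KineticCurrentsLDAlongFamilies`, stmt-AtomisticToContinuum-16659): along a jointly
continuous positive profile family on `[0,t₁] × 𝕋³`, `0 < σ ≤ 1/2`, `κ > 0`, there is `δ > 0`
with `∫ g dλ^N_{s'} ≤ (∫ g² dλ^N_s)^{1/2} · e^{κ(N+1)}` for every flow family, EVERY `N`, all
`s, s' ∈ [0,t₁]`, `|s − s'| ≤ δ`, and every Liouville-a.e.-measurable `g ≥ 0` (static order-`2`
Rényi cost + Cauchy–Schwarz in `ℝ≥0∞`). [folklore] -/
theorem stub_lawChangeFamily :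
    ∀ (t₁ : ℝ) (a θ₀ : ℝ → T3 → ℝ) (u₀ : ℝ → T3 → V3),
    Continuous (Function.uncurry a) → Continuous (Function.uncurry θ₀) →
    Continuous (Function.uncurry u₀) → (∀ s x, 0 < a s x) → (∀ s x, 0 < θ₀ s x) →
    ∀ σ : ℝ, 0 < σ → σ ≤ 1 / 2 → ∀ κ : ℝ, 0 < κ → ∃ δ : ℝ, 0 < δ ∧
    ∀ Φ : (N : ℕ) →
      HardSphereFlow (Literature.Analysis.FluidPDE.Torus.geometry (Fin 3)) (hsDiameter σ N) (N + 1),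
    ∀ N : ℕ, ∀ s ∈ Icc 0 t₁, ∀ s' ∈ Icc 0 t₁, |s - s'| ≤ δ →
    ∀ g : Config (N + 1) (Fin 3) T3 → ℝ≥0∞,
      AEMeasurable g
        (liouville (Literature.Analysis.FluidPDE.Torus.geometry (Fin 3)) (N + 1) (hsDiameter σ N)) →
      ∫⁻ z, g z ∂(localGibbsLaw σ (a s') (u₀ s') (θ₀ s') N (Φ N)) ≤
        (∫⁻ z, g z ^ 2 ∂(localGibbsLaw σ (a s) (u₀ s) (θ₀ s) N (Φ N))) ^ (1 / 2 : ℝ) *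
          ENNReal.ofReal (Real.exp (κ * ((N : ℝ) + 1))) := by
  intro t₁ a θ₀ u₀ ha hθ hu ha0 hθ0 σ hσ hσ2 κ hκ
  -- uniform bounds of the profiles on `[0, t₁] × 𝕋³`
  obtain ⟨Θ, hΘ0, hΘ⟩ := LawChange.exists_bounds t₁ hθ hθ0
  obtain ⟨Λ, -, hΛ⟩ := LawChange.exists_bounds t₁ ha ha0
  -- the tolerance for the Rényi order `2` and the budget `κ`
  obtain ⟨e, he0, he1, hBe, hKe⟩ :=
    KineticCurrentsWindowLDUniformSigmaUniform.StaticFreezing.exists_tolerance (p := 2) (δ := κ)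
      (A := 7 / 2 + Θ⁻¹⁻¹) (B := (1 + Θ⁻¹⁻¹) * Θ) one_lt_two hκ (by positivity) (by positivity)
  -- one transverse modulus of the data `(log a, log θ₀, u₀, θ₀⁻¹)`
  obtain ⟨δ₁, hδ₁, h₁⟩ := LawChange.exists_family_modulus t₁
    (F := fun q : ℝ × T3 => Real.log (a q.1 q.2)) (ha.log fun q => (ha0 q.1 q.2).ne') he0
  obtain ⟨δ₂, hδ₂, h₂⟩ := LawChange.exists_family_modulus t₁
    (F := fun q : ℝ × T3 => Real.log (θ₀ q.1 q.2)) (hθ.log fun q => (hθ0 q.1 q.2).ne') he0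
  obtain ⟨δ₃, hδ₃, h₃⟩ := LawChange.exists_family_modulus t₁ (F := Function.uncurry u₀) hu he0
  obtain ⟨δ₄, hδ₄, h₄⟩ := LawChange.exists_family_modulus t₁
    (F := fun q : ℝ × T3 => (θ₀ q.1 q.2)⁻¹) (hθ.inv₀ fun q => (hθ0 q.1 q.2).ne') he0
  refine ⟨min (min δ₁ δ₂) (min δ₃ δ₄), by positivity, fun Φ N s hs s' hs' hss' g hg => ?_⟩
  -- closeness of the data at `s` and `s'`
  have hla : ∀ x, |Real.log (a s x) - Real.log (a s' x)| < e := fun x => Real.dist_eq _ _ ▸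
    h₁ s hs s' hs' (hss'.trans ((min_le_left _ _).trans (min_le_left _ _))) x
  have hlθ : ∀ x, |Real.log (θ₀ s x) - Real.log (θ₀ s' x)| < e := fun x => Real.dist_eq _ _ ▸
    h₂ s hs s' hs' (hss'.trans ((min_le_left _ _).trans (min_le_right _ _))) x
  have hlu : ∀ x, ‖u₀ s' x - u₀ s x‖ < e := fun x => by
    rw [← dist_eq_norm, dist_comm]
    exact h₃ s hs s' hs' (hss'.trans ((min_le_right _ _).trans (min_le_left _ _))) x
  have hlι : ∀ x, |(θ₀ s x)⁻¹ - (θ₀ s' x)⁻¹| < e := fun x => Real.dist_eq _ _ ▸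
    h₄ s hs s' hs' (hss'.trans ((min_le_right _ _).trans (min_le_right _ _))) x
  -- the order-2 Rényi integral of `λ_{s'}` against `λ_s`, then Cauchy–Schwarz
  have hR := LawChange.renyi_le_of_close (ha.uncurry_left s') (hθ.uncurry_left s')
    (hu.uncurry_left s') (ha.uncurry_left s) (hθ.uncurry_left s) (hu.uncurry_left s) (ha0 s')
    (hθ0 s') (ha0 s) (hθ0 s) hσ hσ2 one_lt_two (inv_pos.2 hΘ0) (fun x => (hΘ s hs x).1)
    (fun x => (hΘ s' hs' x).2) (fun x => (hΛ s' hs' x).2) he0 he1 hBe hKe hla hlθ hlu hlι N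
  have h := LawChange.lintegral_le_of_renyi_two (ha.uncurry_left s') (hθ.uncurry_left s')
    (hu.uncurry_left s') (ha.uncurry_left s) (hθ.uncurry_left s) (hu.uncurry_left s) (ha0 s)
    (hθ0 s) hσ2 (Φ N) _ hR g hg
  rwa [LawChange.ofReal_exp_mul_rpow_inv two_pos] at h

end Summit.AtomisticToContinuum.HydrodynamicLimit.Theorems.KineticCurrentsLDAlongFamiliesSketch

end
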